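import Literature.Computability.Cryptography.YaoNextBitPrograms
import Literature.Computability.Cryptography.IndistinguishabilityProofs
import Literature.Computability.Cryptography.FiniteHybrids
import HarnessLib

/-!
# Yao's theorem (pseudorandomness versus unpredictability): the probability identities

Probability layer for the discharge of
`Literature.Computability.Cryptography.isPseudorandom_iff_isNextBitUnpredictable` (Yao 1982;
Goldreich 2001, Thm. 3.3.7; Arora–Barak 2009, Thm. 9.11), about the two reductions of
`YaoNextBitPrograms.lean`. Everything is an exact finite computation (no asymptotics here):

* bridges between the tree's `PMF`-valued notions (`RandAlg.outputPMF`, `acceptPMF`,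
  `nextBitPMF`) and uniform counting probabilities `uProb` on coin spaces (`FiniteHybrids.lean`),
  via the coin-space equivalences of `YaoNextBitPrograms.lean` ("a uniform string of length
  `a + b` is a uniform prefix and an independent uniform suffix", `splitVec`; "prefix, pivot bit,
  suffix", `pivotEquiv`; "first bit, rest", `headEquiv`);
* `nextBitAdvantage_eq`: the next-bit advantage at a level with `ℓ n = m + 1` is the average over
  the `m + 1` positions of the per-position success probabilities `succProb`, minus `1/2`;
* **only-if direction** (Goldreich 2001, p. 120): at a level where the coin budget of the
  distinguisher `distAlg A qA cl` encodes the position `i₀` and `A`'s coin count,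
  `Pr[D_A(1ⁿ, X_n) = 1] = succProb i₀` (`acceptPMF_distAlg_eq`) and `Pr[D_A(1ⁿ, U_m) = 1] = 1/2`
  (`acceptPMF_distAlg_uniformBits`: a uniform next bit is independent of the prefix);
* **opposite direction** (Goldreich 2001, Claims 3.3.7.1–3.3.7.2, pp. 121–123): the one-step
  identity `Pr[A_D correct at position i | x] = 1/2 + Pr[D(H^{i+1}_x) = 1] − Pr[D(H^i_x) = 1]`
  (`uProb_predict_step`, the computation with the distribution `Z` of the printed proof), the
  telescoping sum over the positions, and the resulting level identity
  `nextBitAdvantage (predAlg D ℓ cl) X ℓ n = (Pr[D(1ⁿ, X_n) = 1] − Pr[D(1ⁿ, U_m) = 1]) / m`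
  (`nextBitAdvantage_predAlg`).

## References

* O. Goldreich, *Foundations of Cryptography I: Basic Tools*, CUP 2001, §3.3.5, Thm. 3.3.7 and
  its proof (Claims 3.3.7.1, 3.3.7.2).
* S. Arora, B. Barak, *Computational Complexity: A Modern Approach*, CUP 2009, Thm. 9.11.
* A. C. Yao, *Theory and applications of trapdoor functions*, FOCS 1982.
-/

noncomputable section

namespace Literature.Computability.Cryptography

open Filter Asymptotics _root_.Computability Complexity Finset
open scoped ENNReal

namespace YaoNB

/-! ### Uniform probabilities: complement and constants -/

section UProb

variable {Ω : Type*} [Fintype Ω]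

/-- Complementary events. [folklore] -/
theorem uProb_not [Nonempty Ω] (E : Ω → Bool) : uProb (fun ω => !E ω) = 1 - uProb E := by
  rw [uProb_eq_sum_div, uProb_eq_sum_div]
  have hc : (0 : ℝ) < Fintype.card Ω := by exact_mod_cast Fintype.card_pos
  have h : ∀ ω, ((!E ω).toNat : ℝ) = 1 - (E ω).toNat := fun ω => by cases E ω <;> simp
  simp_rw [h, Finset.sum_sub_distrib, Finset.sum_const, card_univ, nsmul_eq_mul, mul_one]
  field_simp

/-- The sure event. [folklore] -/
theorem uProb_const_true [Nonempty Ω] : uProb (fun _ : Ω => true) = 1 := by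
  rw [uProb_eq_sum_div]
  have hc : (0 : ℝ) < Fintype.card Ω := by exact_mod_cast Fintype.card_pos
  simp only [Bool.toNat_true, Nat.cast_one, sum_const, card_univ, nsmul_eq_mul, mul_one]
  exact div_self hc.ne'

/-- A fair bit against a fixed target: `Pr_b[c == b] = 1/2`... in the form used below:
on `S × Bool`, an event "`g s = b`" has probability `1/2`. [folklore] -/
theorem uProb_beq_snd {S : Type*} [Fintype S] [Nonempty S] (g : S → Bool) :
    uProb (fun p : S × Bool => g p.1 == p.2) = 1 / 2 := by
  rw [uProb_prod_bool]
  have h1 : (fun s : S => g s == true) = g := funext fun s => by cases g s <;> rfl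
  have h0 : (fun s : S => g s == false) = fun s => !g s := funext fun s => by cases g s <;> rfl
  simp only [h1, h0, uProb_not]
  ring

end UProb

/-! ### Prefixes and splittings of uniform coin strings -/

/-- **A prefix of a uniform string is uniform** (with a spectator coordinate `S`): an event
reading only the first `κ` of `κ + e` uniform coins. [folklore] -/
theorem uProb_take_prefix {S : Type*} [Fintype S] (E : S → List Bool → Bool) (κ e : ℕ) :
    uProb (fun p : S × List.Vector Bool (κ + e) => E p.1 (p.2.toList.take κ)) =
      uProb (fun p : S × List.Vector Bool κ => E p.1 p.2.toList) := by
  rw [← uProb_comp_equiv ((Equiv.refl S).prodCongr (splitVec κ e)).symm]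
  have h : (fun ω' : S × (List.Vector Bool κ × List.Vector Bool e) =>
      E (((Equiv.refl S).prodCongr (splitVec κ e)).symm ω').1 ((((Equiv.refl S).prodCongr (splitVec κ e)).symm ω').2.toList.take κ)) =
      fun ω' => E ω'.1 ω'.2.1.toList := by
    funext ω'
    simp [Equiv.prodCongr_symm, List.take_left' ω'.2.1.toList_length]
  rw [h, ← uProb_comp_equiv (Equiv.prodAssoc S (List.Vector Bool κ) (List.Vector Bool e))]
  simp only [Equiv.prodAssoc_apply]
  exact uProb_fst (Ω' := List.Vector Bool e) (fun p : S × List.Vector Bool κ => E p.1 p.2.toList)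

/-- A prefix of a uniform string is uniform (no spectator). [folklore] -/
theorem uProb_take_prefix' (E : List Bool → Bool) (κ e : ℕ) :
    uProb (fun c : List.Vector Bool (κ + e) => E (c.toList.take κ)) = uProb (fun r : List.Vector Bool κ => E r.toList) := by
  rw [← uProb_comp_equiv (splitVec κ e).symm]
  simp only [splitVec_symm_apply_toList]
  have h : (fun ω' : List.Vector Bool κ × List.Vector Bool e => E ((ω'.1.toList ++ ω'.2.toList).take κ)) =
      fun ω' => E ω'.1.toList := funext fun ω' => by rw [List.take_left' ω'.1.toList_length]
  rw [h]
  exact uProb_fst (Ω' := List.Vector Bool e) (fun r : List.Vector Bool κ => E r.toList)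

/-! ### From `PMF` values to counting probabilities -/

/-- A push-forward of a uniform distribution, evaluated at a Boolean value, as a count. [folklore] -/
theorem toReal_map_uniform_apply {Ω : Type*} [Fintype Ω] [Nonempty Ω] (f : Ω → Bool) (b : Bool) :
    (((PMF.uniformOfFintype Ω).map f) b).toReal = uProb (fun ω => f ω == b) := by
  classical
  rw [PMF.map_apply, tsum_fintype, uProb_eq_sum_div, Finset.sum_div]
  rw [ENNReal.toReal_sum (fun ω _ => by split_ifs <;> simp)]
  refine Finset.sum_congr rfl fun ω _ => ?_
  by_cases h : b = f ω
  · subst h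
    simp [PMF.uniformOfFintype_apply, ENNReal.toReal_inv]
  · have h' : (f ω == b) = false := by cases hf : f ω <;> cases b <;> simp_all
    simp [h, h']

/-- **The output distribution of a randomized algorithm as a count of coin strings.** [folklore] -/
theorem toReal_outputPMF_apply (A : RandAlg (List Bool) Bool) (w : List Bool) {κ : ℕ}
    (hκ : A.coinLen w.length = κ) (b : Bool) :
    (A.outputPMF id w b).toReal = uProb (fun r : List.Vector Bool κ => A.run w r.toList == b) := by
  subst hκ
  exact toReal_map_uniform_apply _ b

/-- The same for a post-processed output. [folklore] -/
theorem toReal_map_outputPMF_apply (A : RandAlg (List Bool) Bool) (w : List Bool) {κ : ℕ}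
    (hκ : A.coinLen w.length = κ) (g : Bool → Bool) (b : Bool) :
    (((A.outputPMF id w).map g) b).toReal = uProb (fun r : List.Vector Bool κ => g (A.run w r.toList) == b) := by
  subst hκ
  rw [RandAlg.outputPMF, PMF.map_comp]
  exact toReal_map_uniform_apply _ b

/-- A `bind` evaluated at a point, in `ℝ`. [folklore] -/
theorem toReal_bind_apply {α : Type*} (X : PMF α) (f : α → PMF Bool) (b : Bool) :
    ((X.bind f) b).toReal = ∑' a, (X a).toReal * (f a b).toReal := by
  rw [PMF.bind_apply, ENNReal.tsum_toReal_eq]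
  · exact tsum_congr fun s => ENNReal.toReal_mul
  · intro s; exact ENNReal.mul_ne_top (X.apply_ne_top s) (PMF.apply_ne_top _ _)

/-! ### Weighted sums against a distribution -/

section Weighted

variable {α : Type*} (X : PMF α)

/-- Bounded integrands are summable against a distribution. [folklore] -/
theorem summable_toReal_mul {g : α → ℝ} {M : ℝ} (hg : ∀ a, |g a| ≤ M) :
    Summable fun a => (X a).toReal * g a := by
  refine Summable.of_norm_bounded (g := fun a => (X a).toReal * M)
    ((ENNReal.summable_toReal X.tsum_coe_ne_top).mul_right M) fun a => ?_
  rw [norm_mul, Real.norm_of_nonneg ENNReal.toReal_nonneg, Real.norm_eq_abs]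
  exact mul_le_mul_of_nonneg_left (hg a) ENNReal.toReal_nonneg

/-- The total mass is `1`, in `ℝ`. [folklore] -/
theorem tsum_toReal_eq_one : ∑' a, (X a).toReal = 1 := by
  rw [← ENNReal.tsum_toReal_eq (fun a => X.apply_ne_top a), X.tsum_coe, ENNReal.toReal_one]

/-- Constants integrate to themselves. [folklore] -/
theorem tsum_toReal_mul_const (c : ℝ) : ∑' a, (X a).toReal * c = c := by
  rw [tsum_mul_right, tsum_toReal_eq_one, one_mul]

/-- Integrands that agree on the support have the same integral. [folklore] -/
theorem tsum_toReal_mul_congr {g h : α → ℝ} (hgh : ∀ a, X a ≠ 0 → g a = h a) :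
    ∑' a, (X a).toReal * g a = ∑' a, (X a).toReal * h a := by
  refine tsum_congr fun a => ?_
  by_cases ha : X a = 0
  · simp [ha]
  · rw [hgh a ha]

end Weighted


/-- Splitting off a prefix of the coins: an event of (prefix, rest) on `a + b` uniform coins is the
same event on a uniform pair. [folklore] -/
theorem uProb_split (G : List Bool → List Bool → Bool) (a b : ℕ) :
    uProb (fun c : List.Vector Bool (a + b) => G (c.toList.take a) (c.toList.drop a)) =
      uProb (fun p : List.Vector Bool a × List.Vector Bool b => G p.1.toList p.2.toList) := by
  rw [← uProb_comp_equiv (splitVec a b).symm]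
  refine uProb_congr fun p => ?_
  simp only [splitVec_symm_apply_toList]
  rw [List.take_left' p.1.toList_length, List.drop_left' p.1.toList_length]

/-- Splitting off the first coin: average over its two values. [folklore] -/
theorem uProb_split_head {R : Type*} [Fintype R] (E : List Bool → R → Bool) (e : ℕ) :
    uProb (fun p : List.Vector Bool (e + 1) × R => E p.1.toList p.2) =
      (uProb (fun s : List.Vector Bool e × R => E (false :: s.1.toList) s.2) +
        uProb (fun s : List.Vector Bool e × R => E (true :: s.1.toList) s.2)) / 2 := by
  rw [← uProb_comp_equiv (headEquiv e R).symm, uProb_prod_bool]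
  simp only [headEquiv_symm_apply_fst_toList, headEquiv_symm_apply_snd]

/-- **A uniform next bit cannot be predicted from the prefix**: for `i < m` and a uniform
`m`-bit string, any test of (prefix of length `i`, independent coins) agrees with bit `i + 1`
with probability exactly `1/2`. [Goldreich 2001, Thm. 3.3.7 (proof, only-if direction:
"the uniform ensemble is unpredictable regardless of the time bounds")]
[cite: Goldreich2001, Thm. 3.3.7 (proof, only-if direction)] -/
theorem uProb_pivot_half {R : Type*} [Fintype R] [Nonempty R] (g : List Bool → R → Bool) {i m : ℕ} (hi : i < m) :
    uProb (fun p : List.Vector Bool m × R => g (p.1.toList.take i) p.2 == p.1.toList.getD i false) = 1 / 2 := by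
  obtain ⟨e, rfl⟩ : ∃ e, m = i + (e + 1) := ⟨m - i - 1, by omega⟩
  rw [← uProb_comp_equiv (pivotEquiv i e R).symm]
  rw [uProb_congr (E' := fun q : ((List.Vector Bool i × List.Vector Bool e) × R) × Bool => g q.1.1.1.toList q.1.2 == q.2)]
  · exact uProb_beq_snd (fun s : (List.Vector Bool i × List.Vector Bool e) × R => g s.1.1.toList s.2)
  · intro q
    simp only [pivotEquiv_symm_apply_fst_toList, pivotEquiv_symm_apply_snd]
    rw [List.take_left' q.1.1.1.toList_length, List.getD_eq_getElem?_getD,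
      List.getElem?_append_right (by rw [q.1.1.1.toList_length]), q.1.1.1.toList_length, Nat.sub_self,
      List.getElem?_cons_zero, Option.getD_some]

/-! ### The next-bit advantage as an average over the positions -/

/-- `succProb` is a probability: nonnegative. [folklore] -/
theorem succProb_nonneg (A : RandAlg (List Bool) Bool) (n : ℕ) (X : PMF (List Bool)) (i : ℕ) :
    0 ≤ succProb A n X i := ENNReal.toReal_nonneg

/-- `succProb` is a probability: at most `1`. [folklore] -/
theorem succProb_le_one (A : RandAlg (List Bool) Bool) (n : ℕ) (X : PMF (List Bool)) (i : ℕ) :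
    succProb A n X i ≤ 1 :=
  ENNReal.toReal_le_of_le_ofReal zero_le_one (by simpa using PMF.coe_le_one _ _)

/-- Fubini for a finite inner sum, in `ℝ≥0∞`. [folklore] -/
theorem tsum_mul_sum_fin {α : Type*} (w : α → ℝ≥0∞) (c : ℝ≥0∞) {k : ℕ} (M : α → Fin k → ℝ≥0∞) :
    ∑' x, w x * (c * ∑ i, M x i) = c * ∑ i, ∑' x, w x * M x i := by
  calc ∑' x, w x * (c * ∑ i, M x i) = ∑' x, c * ∑ i, w x * M x i :=
        tsum_congr fun x => by rw [mul_left_comm, Finset.mul_sum]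
    _ = c * ∑' x, ∑ i, w x * M x i := ENNReal.tsum_mul_left
    _ = c * ∑ i, ∑' x, w x * M x i := by rw [Summable.tsum_finsetSum (fun i _ => ENNReal.summable)]

/-- The random-position success probability is the average of the per-position ones (Fubini in
`ℝ≥0∞`). [Arora–Barak 2009, Thm. 9.11; Goldreich 2001, proof of Claim 3.3.7.2 (first equality)] [folklore] -/
theorem bind_nextBitPMF_apply (A : RandAlg (List Bool) Bool) (n : ℕ) (X : PMF (List Bool)) (m : ℕ) :
    (X.bind fun x => nextBitPMF A n x m) true =
      ((m + 1 : ℕ) : ℝ≥0∞)⁻¹ * ∑ i : Fin (m + 1), succPMF A n X i true := by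
  have hc : ∀ x : List Bool, (nextBitPMF A n x m) true = ((m + 1 : ℕ) : ℝ≥0∞)⁻¹ *
      ∑ i : Fin (m + 1), ((A.outputPMF id (boolPair (unaryEncodeNat n) (x.take i))).map
        fun b => b == x.getD i false) true := by
    intro x
    rw [nextBitPMF, PMF.bind_apply, tsum_fintype, Finset.mul_sum]
    refine Finset.sum_congr rfl fun i _ => ?_
    rw [PMF.uniformOfFintype_apply, Fintype.card_fin]
  rw [PMF.bind_apply, tsum_congr (fun x => by rw [hc]), tsum_mul_sum_fin]
  rfl

/-- **The next-bit advantage as an average**: at a level with `ℓ n = m + 1`,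
`nextBitAdvantage A X ℓ n = (1/(m+1)) ∑_{i ≤ m} succProb i − 1/2`.
[Goldreich 2001, proof of Claim 3.3.7.2 (first equality); Arora–Barak 2009, Thm. 9.11] [folklore] -/
theorem nextBitAdvantage_eq (A : RandAlg (List Bool) Bool) (X : Ensemble (List Bool)) (ℓ : ℕ → ℕ) {n m : ℕ}
    (hm : ℓ n = m + 1) :
    nextBitAdvantage A X ℓ n = (∑ i : Fin (m + 1), succProb A n (X n) i) / (m + 1) - 2⁻¹ := by
  unfold nextBitAdvantage
  rw [hm]
  simp only
  rw [bind_nextBitPMF_apply, ENNReal.toReal_mul, ENNReal.toReal_inv, ENNReal.toReal_natCast,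
    ENNReal.toReal_sum (fun i _ => PMF.apply_ne_top _ _), inv_mul_eq_div]
  push_cast
  rfl

/-- **Some position is as biased as the average**: there is `i₀ < m` with
`|nextBitAdvantage| ≤ |succProb i₀ − 1/2|`. [folklore] -/
theorem exists_abs_nextBitAdvantage_le (A : RandAlg (List Bool) Bool) (X : Ensemble (List Bool)) (ℓ : ℕ → ℕ)
    {n m : ℕ} (hm : ℓ n = m) (hm0 : 0 < m) :
    ∃ i₀ < m, |nextBitAdvantage A X ℓ n| ≤ |succProb A n (X n) i₀ - 1 / 2| := by
  obtain ⟨m', rfl⟩ : ∃ m', m = m' + 1 := ⟨m - 1, by omega⟩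
  rw [nextBitAdvantage_eq A X ℓ hm]
  obtain ⟨i₀, -, hmax⟩ := Finset.exists_max_image (Finset.univ : Finset (Fin (m' + 1)))
    (fun i => |succProb A n (X n) i - 1 / 2|) Finset.univ_nonempty
  refine ⟨i₀, i₀.isLt, ?_⟩
  have hpos : (0 : ℝ) < m' + 1 := by positivity
  have hsum : (∑ i : Fin (m' + 1), succProb A n (X n) i) / (m' + 1) - 2⁻¹ =
      (∑ i : Fin (m' + 1), (succProb A n (X n) i - 1 / 2)) / (m' + 1) := by
    rw [Finset.sum_sub_distrib, Finset.sum_const, Finset.card_univ, Fintype.card_fin, nsmul_eq_mul]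
    push_cast
    field_simp
  rw [hsum, abs_div, abs_of_pos hpos, div_le_iff₀ hpos]
  calc |∑ i : Fin (m' + 1), (succProb A n (X n) i - 1 / 2)|
      ≤ ∑ i : Fin (m' + 1), |succProb A n (X n) i - 1 / 2| := Finset.abs_sum_le_sum_abs _ _
    _ ≤ ∑ _i : Fin (m' + 1), |succProb A n (X n) i₀ - 1 / 2| := Finset.sum_le_sum fun i _ => hmax i (Finset.mem_univ _)
    _ = |succProb A n (X n) i₀ - 1 / 2| * (m' + 1) := by
      rw [Finset.sum_const, Finset.card_univ, Fintype.card_fin, nsmul_eq_mul]; push_cast; ring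

/-! ### Acceptance probabilities on the uniform distribution -/

/-- `Pr[D(1ⁿ, U_m) = 1]` as a count over (input string, coins). [Goldreich 2001, Def. 3.2.2] [folklore] -/
theorem toReal_acceptPMF_uniformBits (D : RandAlg (List Bool) Bool) (n m : ℕ) {κ : ℕ}
    (hκ : D.coinLen (2 * n + 2 + m) = κ) :
    (acceptPMF D n (uniformBits m) true).toReal =
      uProb (fun p : List.Vector Bool m × List.Vector Bool κ => D.run (boolPair (unaryEncodeNat n) p.1.toList) p.2.toList) := by
  rw [acceptPMF, uniformBits, PMF.bind_map, toReal_bind_apply, tsum_fintype, uProb_prod_eq_avg, Finset.sum_div]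
  refine Finset.sum_congr rfl fun v _ => ?_
  have hlen : D.coinLen (boolPair (unaryEncodeNat n) v.toList).length = κ := by
    rw [length_boolPair_unaryEncodeNat, List.Vector.toList_length, hκ]
  rw [Function.comp_apply, toReal_outputPMF_apply D _ hlen, PMF.uniformOfFintype_apply, ENNReal.toReal_inv,
    ENNReal.toReal_natCast, inv_mul_eq_div]
  congr 1
  exact uProb_congr fun r => beq_true _

/-! ### Only-if direction: the distinguisher at a level with an encoding coin budget -/

section DistLevel

variable (A : RandAlg (List Bool) Bool) (qA : Polynomial ℕ) (cl : ℕ → ℕ)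

/-- The run of `D_A` on `⟨1ⁿ, x⟩`, `|x| = m`, when the coin length is `κ + B i₀` with
`κ = A.coinLen (2n+2+i₀) < B = qA(2n+2+m) + 1`: it tests position `i₀` with `κ` coins for `A`.
[cite: Goldreich2001, Thm. 3.3.7 (proof, only-if direction)] -/
theorem distRun_eq {n m i₀ : ℕ} {x : List Bool} (hx : x.length = m) (c : List Bool)
    (hc : c.length = A.coinLen (2 * n + 2 + i₀) + (qA.eval (2 * n + 2 + m) + 1) * i₀)
    (hκ : A.coinLen (2 * n + 2 + i₀) < qA.eval (2 * n + 2 + m) + 1) :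
    distRun A qA (boolPair (unaryEncodeNat n) x) c =
      (A.run (boolPair (unaryEncodeNat n) (x.take i₀)) (c.take (A.coinLen (2 * n + 2 + i₀))) == x.getD i₀ false) := by
  have hB : 0 < qA.eval (2 * n + 2 + m) + 1 := Nat.succ_pos _
  have hdiv : c.length / (qA.eval (2 * n + 2 + m) + 1) = i₀ := by
    rw [hc, Nat.add_mul_div_left _ _ hB, Nat.div_eq_of_lt hκ, zero_add]
  have hmod : c.length % (qA.eval (2 * n + 2 + m) + 1) = A.coinLen (2 * n + 2 + i₀) := by
    rw [hc, Nat.add_mul_mod_self_left, Nat.mod_eq_of_lt hκ]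
  simp only [distRun, boolUnpair_boolPair, show (unaryEncodeNat n).length = n from unary_decode_encode_nat n, hx, hdiv, hmod]

variable {A qA cl}

/-- **`Pr[D_A(1ⁿ, X_n) = 1] = Pr[A predicts position i₀ + 1 of X_n]`** at a level where `X_n` is
supported on `m`-bit strings and the coin budget encodes `(i₀, κ)`.
[cite: Goldreich2001, Thm. 3.3.7 (proof, only-if direction)] -/
theorem acceptPMF_distAlg_eq {n m i₀ : ℕ} (X : PMF (List Bool)) (hX : ∀ x ∈ X.support, x.length = m)
    (hi : i₀ < m)
    (hcl : cl (2 * n + 2 + m) = A.coinLen (2 * n + 2 + i₀) + (qA.eval (2 * n + 2 + m) + 1) * i₀)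
    (hκ : A.coinLen (2 * n + 2 + i₀) < qA.eval (2 * n + 2 + m) + 1) :
    (acceptPMF (distAlg A qA cl) n X true).toReal = succProb A n X i₀ := by
  rw [acceptPMF, succProb, succPMF, toReal_bind_apply, toReal_bind_apply]
  refine tsum_toReal_mul_congr X fun x hx0 => ?_
  have hx : x.length = m := hX x ((PMF.mem_support_iff X x).2 hx0)
  have hlen : (distAlg A qA cl).coinLen (boolPair (unaryEncodeNat n) x).length =
      A.coinLen (2 * n + 2 + i₀) + (qA.eval (2 * n + 2 + m) + 1) * i₀ := by
    show cl _ = _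
    rw [length_boolPair_unaryEncodeNat, hx, hcl]
  have hlen' : A.coinLen (boolPair (unaryEncodeNat n) (x.take i₀)).length = A.coinLen (2 * n + 2 + i₀) := by
    rw [length_boolPair_unaryEncodeNat, List.length_take, hx, min_eq_left hi.le]
  rw [toReal_outputPMF_apply _ _ hlen, toReal_map_outputPMF_apply _ _ hlen',
    ← uProb_take_prefix' (fun r => (A.run (boolPair (unaryEncodeNat n) (x.take i₀)) r == x.getD i₀ false) == true)
      (A.coinLen (2 * n + 2 + i₀)) ((qA.eval (2 * n + 2 + m) + 1) * i₀)]
  refine uProb_congr fun c => ?_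
  show (distRun A qA (boolPair (unaryEncodeNat n) x) c.toList == true) = _
  rw [distRun_eq A qA hx c.toList (by rw [List.Vector.toList_length]) hκ]

/-- **`Pr[D_A(1ⁿ, U_m) = 1] = 1/2`** at such a level: a uniform next bit is independent of the
prefix and of `A`'s coins. [cite: Goldreich2001, Thm. 3.3.7 (proof, only-if direction)] -/
theorem acceptPMF_distAlg_uniformBits {n m i₀ : ℕ} (hi : i₀ < m)
    (hcl : cl (2 * n + 2 + m) = A.coinLen (2 * n + 2 + i₀) + (qA.eval (2 * n + 2 + m) + 1) * i₀)
    (hκ : A.coinLen (2 * n + 2 + i₀) < qA.eval (2 * n + 2 + m) + 1) :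
    (acceptPMF (distAlg A qA cl) n (uniformBits m) true).toReal = 1 / 2 := by
  have hlen : (distAlg A qA cl).coinLen (2 * n + 2 + m) = A.coinLen (2 * n + 2 + i₀) + (qA.eval (2 * n + 2 + m) + 1) * i₀ := hcl
  rw [toReal_acceptPMF_uniformBits (distAlg A qA cl) n m hlen]
  refine (uProb_congr (E' := fun p : List.Vector Bool m × List.Vector Bool (A.coinLen (2 * n + 2 + i₀) + (qA.eval (2 * n + 2 + m) + 1) * i₀) =>
      A.run (boolPair (unaryEncodeNat n) (p.1.toList.take i₀)) (p.2.toList.take (A.coinLen (2 * n + 2 + i₀))) == p.1.toList.getD i₀ false)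
      (fun p => distRun_eq A qA p.1.toList_length p.2.toList (by rw [List.Vector.toList_length]) hκ)).trans ?_
  rw [uProb_take_prefix (fun (s : List.Vector Bool m) (r : List Bool) =>
      A.run (boolPair (unaryEncodeNat n) (s.toList.take i₀)) r == s.toList.getD i₀ false)]
  exact uProb_pivot_half (fun t (r : List.Vector Bool (A.coinLen (2 * n + 2 + i₀))) => A.run (boolPair (unaryEncodeNat n) t) r.toList) hi

/-- **The distinguishing gap of `D_A` at such a level is the bias of `A` at position `i₀`.**
[cite: Goldreich2001, Thm. 3.3.7 (proof, only-if direction)] -/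
theorem distAdvantage_distAlg (X : Ensemble (List Bool)) (ℓ : ℕ → ℕ) {n m i₀ : ℕ} (hm : ℓ n = m)
    (hX : ∀ x ∈ (X n).support, x.length = m) (hi : i₀ < m)
    (hcl : cl (2 * n + 2 + m) = A.coinLen (2 * n + 2 + i₀) + (qA.eval (2 * n + 2 + m) + 1) * i₀)
    (hκ : A.coinLen (2 * n + 2 + i₀) < qA.eval (2 * n + 2 + m) + 1) :
    distAdvantage (distAlg A qA cl) X (uniformEnsemble ℓ) n = |succProb A n (X n) i₀ - 1 / 2| := by
  rw [distAdvantage, show uniformEnsemble ℓ n = uniformBits m from by rw [uniformEnsemble, hm],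
    acceptPMF_distAlg_eq (X n) hX hi hcl hκ, acceptPMF_distAlg_uniformBits hi hcl hκ]

end DistLevel

/-! ### Opposite direction: the predictor at a level with a padding coin budget -/

section PredLevel

variable (D : RandAlg (List Bool) Bool) (ℓ : ℕ → ℕ) (cl : ℕ → ℕ)

/-- **The one-step identity** (the computation with the distribution `Z` in the printed proof):
for a test `F` of (string, coins), a fixed prefix `t`, target bit `β` and `e + 1` fresh uniform
bits `u`, the rule "output `u₁` if `F (t u) = 1`, else `¬u₁`" is correct (equals `β`) with
probability `1/2 + Pr[F(t β u') = 1] − Pr[F(t u) = 1]`.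
[Goldreich 2001, proof of Claim 3.3.7.2] [cite: Goldreich2001, Thm. 3.3.7 (proof of Claim 3.3.7.2)] -/
theorem uProb_predict_step {R : Type*} [Fintype R] [Nonempty R] (F : List Bool → R → Bool) (t : List Bool) (β : Bool) (e : ℕ) :
    uProb (fun p : List.Vector Bool (e + 1) × R =>
        (if F (t ++ p.1.toList) p.2 then p.1.toList.headD false else !p.1.toList.headD false) == β) =
      1 / 2 + uProb (fun p : List.Vector Bool e × R => F (t ++ β :: p.1.toList) p.2)
        - uProb (fun p : List.Vector Bool (e + 1) × R => F (t ++ p.1.toList) p.2) := by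
  rw [uProb_split_head (fun l r => (if F (t ++ l) r then l.headD false else !l.headD false) == β) e,
    uProb_split_head (fun l r => F (t ++ l) r) e]
  simp only [List.headD_cons, Bool.not_false, Bool.not_true]
  have h0 : uProb (fun s : List.Vector Bool e × R => (if F (t ++ false :: s.1.toList) s.2 then false else true) == β) =
      uProb (fun s : List.Vector Bool e × R => F (t ++ false :: s.1.toList) s.2 == !β) :=
    uProb_congr fun s => by cases F (t ++ false :: s.1.toList) s.2 <;> cases β <;> rfl
  have h1 : uProb (fun s : List.Vector Bool e × R => (if F (t ++ true :: s.1.toList) s.2 then true else false) == β) =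
      uProb (fun s : List.Vector Bool e × R => F (t ++ true :: s.1.toList) s.2 == β) :=
    uProb_congr fun s => by cases F (t ++ true :: s.1.toList) s.2 <;> cases β <;> rfl
  rw [h0, h1]
  cases β
  · rw [uProb_congr (E := fun s : List.Vector Bool e × R => F (t ++ false :: s.1.toList) s.2 == !false)
        (E' := fun s => F (t ++ false :: s.1.toList) s.2) (fun s => beq_true _),
      uProb_congr (E := fun s : List.Vector Bool e × R => F (t ++ true :: s.1.toList) s.2 == false)
        (E' := fun s => !F (t ++ true :: s.1.toList) s.2) (fun s => by cases F (t ++ true :: s.1.toList) s.2 <;> rfl),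
      uProb_not]
    ring
  · rw [uProb_congr (E := fun s : List.Vector Bool e × R => F (t ++ false :: s.1.toList) s.2 == !true)
        (E' := fun s => !F (t ++ false :: s.1.toList) s.2) (fun s => by cases F (t ++ false :: s.1.toList) s.2 <;> rfl),
      uProb_congr (E := fun s : List.Vector Bool e × R => F (t ++ true :: s.1.toList) s.2 == true)
        (E' := fun s => F (t ++ true :: s.1.toList) s.2) (fun s => beq_true _),
      uProb_not]
    ring

/-- `hyb` is a probability. [folklore] -/
theorem abs_hyb_le (n κ : ℕ) (x : List Bool) (i e : ℕ) : |hyb D n κ x i e| ≤ 1 := by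
  rw [hyb, abs_of_nonneg (uProb_nonneg _)]; exact uProb_le_one _

variable {D ℓ cl}

/-- **Success of `A_D` at position `i + 1`, given `x`**: `1/2 + Pr[D(H^{i+1}_x)=1] − Pr[D(H^i_x)=1]`,
at a level with `ℓ n = m = |x|` and coin budget `(m − i) + κ` on `⟨1ⁿ, x ↾ i⟩`.
[Goldreich 2001, proof of Claim 3.3.7.2] [cite: Goldreich2001, Thm. 3.3.7 (proof of Claim 3.3.7.2)] -/
theorem succ_integrand_predAlg {n m κ : ℕ} (hm : ℓ n = m) {x : List Bool} (hx : x.length = m) {i : ℕ}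
    (hi : i < m) (hcl : cl (2 * n + 2 + i) = (m - i) + κ) :
    ((((predAlg D ℓ cl).outputPMF id (boolPair (unaryEncodeNat n) (x.take i))).map
        fun b => b == x.getD i false) true).toReal =
      1 / 2 + hyb D n κ x (i + 1) (m - (i + 1)) - hyb D n κ x i (m - i) := by
  obtain ⟨e, he⟩ : ∃ e, m - i = e + 1 := ⟨m - i - 1, by omega⟩
  have hlen : (predAlg D ℓ cl).coinLen (boolPair (unaryEncodeNat n) (x.take i)).length = (e + 1) + κ := by
    show cl _ = _
    rw [length_boolPair_unaryEncodeNat, List.length_take, hx, min_eq_left hi.le, hcl, he]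
  rw [toReal_map_outputPMF_apply _ _ hlen]
  have hrun : ∀ c : List Bool, predRun D ℓ (boolPair (unaryEncodeNat n) (x.take i)) c =
      (if D.run (boolPair (unaryEncodeNat n) (x.take i ++ c.take (e + 1))) (c.drop (e + 1))
        then (c.take (e + 1)).headD false else !(c.take (e + 1)).headD false) := by
    intro c
    simp only [predRun, boolUnpair_boolPair, show (unaryEncodeNat n).length = n from unary_decode_encode_nat n,
      List.length_take, hx, min_eq_left hi.le, hm, he]
  rw [uProb_congr (E' := fun c : List.Vector Bool ((e + 1) + κ) =>
      ((if D.run (boolPair (unaryEncodeNat n) (x.take i ++ c.toList.take (e + 1))) (c.toList.drop (e + 1))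
        then (c.toList.take (e + 1)).headD false else !(c.toList.take (e + 1)).headD false) == x.getD i false))
      (fun c => by show ((predRun D ℓ _ c.toList == _) == true) = _; rw [hrun, beq_true])]
  rw [uProb_split (fun u r => (if D.run (boolPair (unaryEncodeNat n) (x.take i ++ u)) r
      then u.headD false else !u.headD false) == x.getD i false) (e + 1) κ,
    uProb_predict_step (fun l (r : List.Vector Bool κ) => D.run (boolPair (unaryEncodeNat n) l) r.toList)
      (x.take i) (x.getD i false) e]
  have h1 : m - (i + 1) = e := by omega
  rw [h1, he]
  have hi' : i < x.length := by omega
  have htake : ∀ l : List Bool, x.take i ++ x.getD i false :: l = x.take (i + 1) ++ l := fun l => by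
    rw [List.take_succ_eq_append_getElem hi', List.getD_eq_getElem _ _ hi', List.append_assoc, List.singleton_append]
  simp only [hyb, htake]

/-- At the last position the hybrid is the real distribution: `hyb x m 0 = Pr[D(1ⁿ, x) = 1]`
(for `|x| = m`, `κ = D.coinLen (2n+2+m)`). [folklore] -/
theorem hyb_self {n m κ : ℕ} {x : List Bool} (hx : x.length = m) (hκ : D.coinLen (2 * n + 2 + m) = κ) :
    hyb D n κ x m 0 = (D.outputPMF id (boolPair (unaryEncodeNat n) x) true).toReal := by
  have hlen : D.coinLen (boolPair (unaryEncodeNat n) x).length = κ := by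
    rw [length_boolPair_unaryEncodeNat, hx, hκ]
  rw [toReal_outputPMF_apply D _ hlen, hyb]
  rw [uProb_congr (E' := fun p : List.Vector Bool 0 × List.Vector Bool κ => D.run (boolPair (unaryEncodeNat n) x) p.2.toList)]
  · exact (uProb_snd (Ω := List.Vector Bool 0) (fun r : List.Vector Bool κ => D.run (boolPair (unaryEncodeNat n) x) r.toList)).trans
      (uProb_congr fun r => (beq_true _).symm)
  · intro p
    have h0 : p.1.toList = [] := List.eq_nil_of_length_eq_zero p.1.toList_length
    rw [h0, List.append_nil, List.take_of_length_le (by omega)]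

/-- At position `0` the hybrid is the uniform distribution: `hyb x 0 m = Pr[D(1ⁿ, U_m) = 1]`. [folklore] -/
theorem hyb_zero {n m κ : ℕ} (x : List Bool) (hκ : D.coinLen (2 * n + 2 + m) = κ) :
    hyb D n κ x 0 m = (acceptPMF D n (uniformBits m) true).toReal := by
  rw [toReal_acceptPMF_uniformBits D n m hκ, hyb]
  simp only [List.take_zero, List.nil_append]

/-- **The telescoping sum over the positions** (Claims 3.3.7.1–3.3.7.2 combined, as an identity):
`∑_{i<m} succProb_i(A_D) = m/2 + Pr[D(1ⁿ, X) = 1] − Pr[D(1ⁿ, U_m) = 1]`.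
[cite: Goldreich2001, Thm. 3.3.7 (proof of Claim 3.3.7.2)] -/
theorem sum_succProb_predAlg {n m : ℕ} (hm : ℓ n = m) (X : PMF (List Bool)) (hX : ∀ x ∈ X.support, x.length = m)
    {κ : ℕ} (hκ : D.coinLen (2 * n + 2 + m) = κ) (hcl : ∀ i < m, cl (2 * n + 2 + i) = (m - i) + κ) :
    ∑ i ∈ Finset.range m, succProb (predAlg D ℓ cl) n X i =
      m / 2 + (acceptPMF D n X true).toReal - (acceptPMF D n (uniformBits m) true).toReal := by
  set f : ℕ → ℝ := fun j => ∑' x, (X x).toReal * hyb D n κ x j (m - j) with hf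
  have hsum : ∀ j, Summable fun x => (X x).toReal * hyb D n κ x j (m - j) := fun j =>
    summable_toReal_mul X fun x => abs_hyb_le D n κ x j (m - j)
  have hhalf : Summable fun x => (X x).toReal * (1 / 2 : ℝ) :=
    summable_toReal_mul X (M := 1 / 2) fun x => by rw [abs_of_nonneg (by norm_num)]
  have hterm : ∀ i ∈ Finset.range m, succProb (predAlg D ℓ cl) n X i = 1 / 2 + (f (i + 1) - f i) := by
    intro i hi
    rw [Finset.mem_range] at hi
    rw [succProb, succPMF, toReal_bind_apply,
      tsum_toReal_mul_congr X (h := fun x => 1 / 2 + hyb D n κ x (i + 1) (m - (i + 1)) - hyb D n κ x i (m - i))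
        (fun x hx0 => succ_integrand_predAlg hm (hX x ((PMF.mem_support_iff X x).2 hx0)) hi (hcl i hi))]
    simp only [hf, mul_sub, mul_add]
    rw [Summable.tsum_sub (hhalf.add (hsum (i + 1))) (hsum i), Summable.tsum_add hhalf (hsum (i + 1)),
      tsum_toReal_mul_const]
    ring
  rw [Finset.sum_congr rfl hterm, Finset.sum_add_distrib, Finset.sum_const, Finset.card_range,
    Finset.sum_range_sub f m, nsmul_eq_mul]
  have hfm : f m = (acceptPMF D n X true).toReal := by
    simp only [hf, Nat.sub_self]
    rw [acceptPMF_true_toReal]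
    exact tsum_toReal_mul_congr X fun x hx0 => hyb_self (hX x ((PMF.mem_support_iff X x).2 hx0)) hκ
  have hf0 : f 0 = (acceptPMF D n (uniformBits m) true).toReal := by
    simp only [hf, Nat.sub_zero]
    rw [tsum_congr (fun x => by rw [hyb_zero x hκ]), tsum_toReal_mul_const]
  rw [hfm, hf0]
  ring

/-- **The level identity of the opposite direction**: at a level `n` with `ℓ n = m ≥ 1`, `X_n`
supported on `m`-bit strings and coin budget `(m − i) + D.coinLen (2n+2+m)` on the inputs
`⟨1ⁿ, y⟩`, `|y| = i < m`, the predictor `A_D` has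
`nextBitAdvantage = (Pr[D(1ⁿ, X_n) = 1] − Pr[D(1ⁿ, U_m) = 1]) / m`.
[Goldreich 2001, Claims 3.3.7.1 and 3.3.7.2] [cite: Goldreich2001, Thm. 3.3.7 (Claims 3.3.7.1–3.3.7.2)] -/
theorem nextBitAdvantage_predAlg (X : Ensemble (List Bool)) {n m : ℕ} (hm : ℓ n = m) (hm0 : 0 < m)
    (hX : ∀ x ∈ (X n).support, x.length = m)
    (hcl : ∀ i < m, cl (2 * n + 2 + i) = (m - i) + D.coinLen (2 * n + 2 + m)) :
    nextBitAdvantage (predAlg D ℓ cl) X ℓ n =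
      ((acceptPMF D n (X n) true).toReal - (acceptPMF D n (uniformBits m) true).toReal) / m := by
  obtain ⟨m', rfl⟩ : ∃ m', m = m' + 1 := ⟨m - 1, by omega⟩
  rw [nextBitAdvantage_eq (predAlg D ℓ cl) X ℓ hm,
    Fin.sum_univ_eq_sum_range (fun i => succProb (predAlg D ℓ cl) n (X n) i) (m' + 1),
    sum_succProb_predAlg hm (X n) hX rfl hcl]
  push_cast
  field_simp
  ring

end PredLevel

end YaoNB

end Literature.Computability.Cryptography
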